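import Summits.ValiantsHypothesis.ValiantsHypothesis.Theorems.LacunarySymmetroidMatrixDescartesCensusTropicalKLawSlopes

/-!
# Route `KPlusLogSqLaw`, crux `TropicalB` — the SUMSET form of slope counting, and exponents in a generalized arithmetic progression

HONEST FRAMING.  Helper file (seat val-sym-trop-p1 g4, cell `pub-symmetroid`, 2026-08-27) toward the registered stub `stub_tropThin` of
`Cruxes/TropicalB/Lines/birth.lean` (crux `Summit.ValiantsHypothesis.ValiantsHypothesis.Theses.KPlusLogSqLaw.TropicalB`, ledger item
`stmt-ValiantsHypothesis-19771`, route `KPlusLogSqLaw`).  A COUNTING law, valid at every format, in the exponent-structure currency; nothing here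
bounds `TropicalB` inside its window, and nothing is asserted about `WeakLifting`, `KPlusLogSqLaw`, `MatrixDescartes`
(`stmt-ValiantsHypothesis-18050`) or `VP ≠ VNP`.

THE LAW.  Along a sign-alternating chain of dominant terms the slopes `Σᵢ d(λ i)` strictly increase (`TropicalCensus.slope_lt_of_dominant`),
so they are pairwise distinct elements of the finite set of ACHIEVABLE slopes
  `slopeSet m d = {Σᵢ d(λ i) : λ : Fin m → Fin K}` = the `m`-fold iterated sumset of the exponent list `d`.
Hence `n + 1 ≤ #slopeSet m d` (`chain_succ_le_card_slopeSet`).  This is the common source of the tree's slope-counting row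
(`tropRootLawAt_slopeCount`: `#slopeSet ≤ multichoose K m`) and of the tropical degree bound (`chain_le_mul_spread`:
`slopeSet ⊆ [m·D₀, m·D₁]`, here `card_slopeSet_le_of_bounds`), and it gives the ADDITIVE-STRUCTURE refinement: if every exponent lies in a
generalized arithmetic progression of rank `r`, `d l = d₀ + Σ_j a(l,j)·g_j` with digits `a(l,j) ≤ A_j`, then the `m`-fold sumset lies in the
progression with digits `≤ m·A_j`, so `#slopeSet ≤ ∏_j (m·A_j + 1)` (`card_slopeSet_le_of_gap`) and every chain has
`n + 1 ≤ ∏_j (m·A_j + 1)` (`chain_succ_le_of_gap`).  Rank one (`chain_le_of_ap`): exponents in an arithmetic progression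
`d l = d₀ + a(l)·g`, `a(l) ≤ A`, admit at most `m·A` breakpoints WHATEVER the common difference `g` — for `d = (0, g, 2g, …, (K−1)g)` this is
`m(K−1)`, attained by the diagonal design of `…KPlusLogSqLawDiagonalDesign` (`DiagK.le_of_tropRootLawAt`), so the arithmetic-progression
row of the tropical census is exactly `m(K−1)`.  Reading for the thin stub: a design beating `2^{C·log₂² m}` must have an exponent set that is
not contained in any generalized arithmetic progression of rank `r` and sides `A_j` with `Σ_j log₂(m·A_j + 1) ≤ C·log₂² m` — its exponents need
large additive dimension, not merely large size (`chain_le_mul_spread`) or many distinct values (`…TropicalBMergeClasses`).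

All statements are chain-level (`∀ d v ε n θ p, … → n + 1 ≤ …`), the form used by `…TropicalBThinRanges.chain_le_mul_spread`. [folklore]
-/

set_option linter.dupNamespace false
set_option autoImplicit false

namespace Summit.ValiantsHypothesis.ValiantsHypothesis.Theorems.KPlusLogSqLaw.Sumset

open Summit.ValiantsHypothesis.ValiantsHypothesis.Theorems.MatrixDescartes.Negative
open Summit.ValiantsHypothesis.ValiantsHypothesis.Theorems.LacunarySymmetroidMatrixDescartes.TropicalCensus
open scoped BigOperators
open Finset

variable {m K : ℕ}

/-- The set of ACHIEVABLE SLOPES of format `(m, K)` with exponents `d`: all sums `Σᵢ d(λ i)` over class maps `λ : Fin m → Fin K`,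
i.e. the `m`-fold iterated sumset of the list `d` (as integers, the currency of `TropicalCensus.slope`). [folklore] -/
def slopeSet (m : ℕ) (d : Fin K → ℕ) : Finset ℤ :=
  (univ : Finset (Fin m → Fin K)).image fun lam => ∑ i, (d (lam i) : ℤ)

/-- membership in `slopeSet`, unfolded. [folklore] -/
theorem mem_slopeSet {d : Fin K → ℕ} {s : ℤ} :
    s ∈ slopeSet m d ↔ ∃ lam : Fin m → Fin K, ∑ i, (d (lam i) : ℤ) = s := by
  unfold slopeSet
  simp only [mem_image, mem_univ, true_and]

/-- the slope of every Leibniz term is an achievable slope. [folklore] -/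
theorem slope_mem_slopeSet (d : Fin K → ℕ) (p : Equiv.Perm (Fin m) × (Fin m → Fin K)) :
    slope d p ∈ slopeSet m d :=
  mem_slopeSet.mpr ⟨p.2, rfl⟩

/-- **SUMSET LAW.**  Along a sign-alternating chain of dominant terms the slopes are pairwise distinct achievable slopes, so the chain has
at most `#slopeSet m d` terms: `n + 1 ≤ #slopeSet m d`. [folklore] -/
theorem chain_succ_le_card_slopeSet (d : Fin K → ℕ) (v ε : Fin m → Fin m → Fin K → ℤ) {n : ℕ}
    (θ : Fin (n + 1) → ℤ) (p : Fin (n + 1) → Equiv.Perm (Fin m) × (Fin m → Fin K))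
    (hθ : StrictMono θ) (hdom : ∀ k, IsDominant d v ε (θ k) (p k))
    (halt : ∀ k : Fin n, termSign ε (p k.castSucc) * termSign ε (p k.succ) < 0) :
    n + 1 ≤ (slopeSet m d).card := by
  -- consecutive terms are distinct (their signs multiply to a negative number)
  have hne : ∀ k : Fin n, p k.castSucc ≠ p k.succ := by
    intro k h
    have := halt k
    rw [h] at this
    exact absurd this (not_lt.mpr (mul_self_nonneg _))
  -- slopes strictly increase
  have hsm : StrictMono fun k => slope d (p k) := by
    rw [Fin.strictMono_iff_lt_succ]
    intro k
    exact slope_lt_of_dominant d v ε (hθ Fin.castSucc_lt_succ) (hne k) (hdom _) (hdom _)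
  -- hence `k ↦ slope d (p k)` is an injection of `Fin (n+1)` into `slopeSet m d`
  have hinj : Function.Injective fun k : Fin (n + 1) =>
      (⟨slope d (p k), slope_mem_slopeSet d (p k)⟩ : slopeSet m d) := by
    intro k k' h
    apply hsm.injective
    simpa using congrArg Subtype.val h
  have hcard := Fintype.card_le_of_injective _ hinj
  simpa [Fintype.card_fin, Fintype.card_coe] using hcard

/-- **Size bound.**  If every exponent lies in `[D₀, D₁]` then every achievable slope lies in `[m·D₀, m·D₁]`, so
`#slopeSet m d ≤ m·(D₁ − D₀) + 1` (the count behind `…TropicalBThinRanges.chain_le_mul_spread`). [folklore] -/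
theorem card_slopeSet_le_of_bounds (d : Fin K → ℕ) (D₀ D₁ : ℕ) (hd : ∀ l, D₀ ≤ d l ∧ d l ≤ D₁) :
    (slopeSet m d).card ≤ m * (D₁ - D₀) + 1 := by
  have hsub : slopeSet m d ⊆ Icc ((m : ℤ) * D₀) ((m : ℤ) * D₁) := by
    intro s hs
    obtain ⟨lam, rfl⟩ := mem_slopeSet.mp hs
    rw [mem_Icc]
    constructor
    · calc (m : ℤ) * D₀ = ∑ _i : Fin m, (D₀ : ℤ) := by
            rw [sum_const, card_univ, Fintype.card_fin, nsmul_eq_mul]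
        _ ≤ ∑ i, (d (lam i) : ℤ) := sum_le_sum fun i _ => by exact_mod_cast (hd _).1
    · calc ∑ i, (d (lam i) : ℤ) ≤ ∑ _i : Fin m, (D₁ : ℤ) := sum_le_sum fun i _ => by exact_mod_cast (hd _).2
        _ = (m : ℤ) * D₁ := by rw [sum_const, card_univ, Fintype.card_fin, nsmul_eq_mul]
  refine (card_le_card hsub).trans ?_
  rw [Int.card_Icc]
  -- `(m·D₁ + 1 − m·D₀).toNat ≤ m·(D₁ − D₀) + 1`
  rcases le_total D₀ D₁ with hD | hD
  · have e : (m : ℤ) * D₁ + 1 - (m : ℤ) * D₀ = ((m * (D₁ - D₀) + 1 : ℕ) : ℤ) := by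
      rw [Nat.cast_add, Nat.cast_mul, Nat.cast_sub hD]; push_cast; ring
    rw [e, Int.toNat_natCast]
  · have hle : (m : ℤ) * D₁ + 1 - (m : ℤ) * D₀ ≤ 1 := by
      have : (m : ℤ) * D₁ ≤ (m : ℤ) * D₀ := by
        exact mul_le_mul_of_nonneg_left (by exact_mod_cast hD) (by positivity)
      linarith
    calc ((m : ℤ) * D₁ + 1 - (m : ℤ) * D₀).toNat ≤ (1 : ℤ).toNat := Int.toNat_le_toNat hle
      _ = 1 := rfl
      _ ≤ m * (D₁ - D₀) + 1 := Nat.le_add_left 1 _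

/-- **GAP bound.**  If every exponent lies in a generalized arithmetic progression of rank `r` — `d l = d₀ + Σ_j a(l,j)·g_j` with digits
`a(l,j) ≤ A_j` — then every achievable slope is `m·d₀ + Σ_j x_j·g_j` with `x_j ≤ m·A_j`, so `#slopeSet m d ≤ ∏_j (m·A_j + 1)`. [folklore] -/
theorem card_slopeSet_le_of_gap (d : Fin K → ℕ) {r : ℕ} (d₀ : ℕ) (g A : Fin r → ℕ) (a : Fin K → Fin r → ℕ)
    (ha : ∀ l j, a l j ≤ A j) (hd : ∀ l, d l = d₀ + ∑ j, a l j * g j) :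
    (slopeSet m d).card ≤ ∏ j, (m * A j + 1) := by
  classical
  -- the box of digit vectors `x` with `x_j ≤ m·A_j`
  set box : Finset (Fin r → ℕ) := Fintype.piFinset fun j => range (m * A j + 1) with hbox
  have hcardbox : box.card = ∏ j, (m * A j + 1) := by
    rw [hbox, Fintype.card_piFinset]
    simp only [card_range]
  -- every achievable slope is the value of the progression at some point of the box
  have hsub : slopeSet m d ⊆ box.image fun x => ((m * d₀ : ℕ) : ℤ) + ∑ j, ((x j * g j : ℕ) : ℤ) := by
    intro s hs
    obtain ⟨lam, rfl⟩ := mem_slopeSet.mp hs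
    rw [mem_image]
    refine ⟨fun j => ∑ i, a (lam i) j, ?_, ?_⟩
    · rw [hbox, Fintype.mem_piFinset]
      intro j
      rw [mem_range, Nat.lt_succ_iff]
      calc ∑ i, a (lam i) j ≤ ∑ _i : Fin m, A j := sum_le_sum fun i _ => ha _ _
        _ = m * A j := by rw [sum_const, card_univ, Fintype.card_fin, smul_eq_mul]
    · -- `m·d₀ + Σ_j (Σ_i a(λ i, j))·g_j = Σ_i (d₀ + Σ_j a(λ i, j)·g_j) = Σ_i d(λ i)`
      have e : ∀ i, (d (lam i) : ℤ) = (d₀ : ℤ) + ∑ j, ((a (lam i) j * g j : ℕ) : ℤ) := by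
        intro i
        rw [hd (lam i)]
        push_cast
        rfl
      simp_rw [e]
      rw [sum_add_distrib, sum_const, card_univ, Fintype.card_fin, nsmul_eq_mul, sum_comm]
      push_cast
      congr 1
      refine sum_congr rfl fun j _ => ?_
      rw [sum_mul]
  calc (slopeSet m d).card ≤ (box.image fun x => ((m * d₀ : ℕ) : ℤ) + ∑ j, ((x j * g j : ℕ) : ℤ)).card := card_le_card hsub
    _ ≤ box.card := card_image_le
    _ = ∏ j, (m * A j + 1) := hcardbox

/-- **Chains under a GAP hypothesis.**  If every exponent lies in a generalized arithmetic progression of rank `r` with digits `≤ A_j`, then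
every sign-alternating dominant chain of the design has `n + 1 ≤ ∏_j (m·A_j + 1)` terms.  For the thin stub: with `r` ranks and
`log₂(m·A_j + 1) ≤ c·log₂ m` each, this is `2^{r·c·log₂ m}` — the `K + log₂² m` budget whenever `r·c ≤ C·log₂ m`, independently of `K`
and of the size of the exponents. [folklore] -/
theorem chain_succ_le_of_gap (d : Fin K → ℕ) (v ε : Fin m → Fin m → Fin K → ℤ) {n : ℕ}
    (θ : Fin (n + 1) → ℤ) (p : Fin (n + 1) → Equiv.Perm (Fin m) × (Fin m → Fin K))
    (hθ : StrictMono θ) (hdom : ∀ k, IsDominant d v ε (θ k) (p k))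
    (halt : ∀ k : Fin n, termSign ε (p k.castSucc) * termSign ε (p k.succ) < 0)
    {r : ℕ} (d₀ : ℕ) (g A : Fin r → ℕ) (a : Fin K → Fin r → ℕ)
    (ha : ∀ l j, a l j ≤ A j) (hd : ∀ l, d l = d₀ + ∑ j, a l j * g j) :
    n + 1 ≤ ∏ j, (m * A j + 1) :=
  (chain_succ_le_card_slopeSet d v ε θ p hθ hdom halt).trans (card_slopeSet_le_of_gap d d₀ g A a ha hd)

/-- **Arithmetic-progression row.**  If the exponents lie in ONE arithmetic progression, `d l = d₀ + a(l)·g` with `a(l) ≤ A`, then every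
sign-alternating dominant chain has at most `m·A` breakpoints — whatever the common difference `g`.  With `d = (0, g, …, (K−1)g)` this is
`m(K−1)`, the floor certified by the diagonal design (`DiagK.le_of_tropRootLawAt`), so this census row is exact. [folklore] -/
theorem chain_le_of_ap (d : Fin K → ℕ) (v ε : Fin m → Fin m → Fin K → ℤ) {n : ℕ}
    (θ : Fin (n + 1) → ℤ) (p : Fin (n + 1) → Equiv.Perm (Fin m) × (Fin m → Fin K))
    (hθ : StrictMono θ) (hdom : ∀ k, IsDominant d v ε (θ k) (p k))
    (halt : ∀ k : Fin n, termSign ε (p k.castSucc) * termSign ε (p k.succ) < 0)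
    (d₀ g A : ℕ) (a : Fin K → ℕ) (ha : ∀ l, a l ≤ A) (hd : ∀ l, d l = d₀ + a l * g) :
    n ≤ m * A := by
  have h := chain_succ_le_of_gap d v ε θ p hθ hdom halt (r := 1) d₀ (fun _ => g) (fun _ => A) (fun l _ => a l)
    (fun l _ => ha l) (fun l => by rw [hd l]; simp)
  rw [Fin.prod_univ_one] at h
  omega

/-! ## Appended 2026-08-27 (same seat): unit-digit progressions — the exponent CUBE and the exponent PARALLELOGRAM

Reading for the `K = 4` growth fork (`TropicalCensus.TropK4Law 2` vs `¬ TropK4Law 2`): if the four exponents satisfy one additive relation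
of small height, e.g. form a parallelogram `{d₀, d₀+g₁, d₀+g₂, d₀+g₁+g₂}`, the census row is at most QUADRATIC in `m` by counting alone
(`chain_succ_le_parallelogram`), for every `m` and all `g₁, g₂`; so a cubic `K = 4` family, if any, lives on exponent quadruples with no
additive relation of height `≤ m` (the `m`-fold sums must be pairwise distinct profiles).  Nothing here decides the fork. -/

/-- **Unit-digit progressions (exponent cube of rank `r`).**  If every exponent is `d₀ + Σ_j a(l,j)·g_j` with ALL digits `a(l,j) ≤ 1`
(the exponents are vertices of an `r`-dimensional parallelepiped), then every sign-alternating dominant chain has `n + 1 ≤ (m+1)^r` terms,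
whatever the generators `g_j` and whatever `K`. [folklore] -/
theorem chain_succ_le_pow_of_unitDigits (d : Fin K → ℕ) (v ε : Fin m → Fin m → Fin K → ℤ) {n : ℕ}
    (θ : Fin (n + 1) → ℤ) (p : Fin (n + 1) → Equiv.Perm (Fin m) × (Fin m → Fin K))
    (hθ : StrictMono θ) (hdom : ∀ k, IsDominant d v ε (θ k) (p k))
    (halt : ∀ k : Fin n, termSign ε (p k.castSucc) * termSign ε (p k.succ) < 0)
    {r : ℕ} (d₀ : ℕ) (g : Fin r → ℕ) (a : Fin K → Fin r → ℕ)
    (ha : ∀ l j, a l j ≤ 1) (hd : ∀ l, d l = d₀ + ∑ j, a l j * g j) :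
    n + 1 ≤ (m + 1) ^ r := by
  have h := chain_succ_le_of_gap d v ε θ p hθ hdom halt d₀ g (fun _ => 1) a ha hd
  simpa only [mul_one, prod_const, card_univ, Fintype.card_fin] using h

/-- **Exponent parallelogram (`K = 4` reading of the GAP law).**  If the exponents lie in `{d₀, d₀+g₁, d₀+g₂, d₀+g₁+g₂}` — precisely
`d l = d₀ + a₁(l)·g₁ + a₂(l)·g₂` with `a₁(l), a₂(l) ≤ 1` — then every sign-alternating dominant chain has `n + 1 ≤ (m+1)²` terms: on such
supports the quadratic (`TropK4Law 2`-type) bound holds for every `m` by counting, whatever `g₁, g₂` (e.g. `(0, 1, a, a+1)`, `(0, g, h, g+h)`).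
[folklore] -/
theorem chain_succ_le_parallelogram (d : Fin K → ℕ) (v ε : Fin m → Fin m → Fin K → ℤ) {n : ℕ}
    (θ : Fin (n + 1) → ℤ) (p : Fin (n + 1) → Equiv.Perm (Fin m) × (Fin m → Fin K))
    (hθ : StrictMono θ) (hdom : ∀ k, IsDominant d v ε (θ k) (p k))
    (halt : ∀ k : Fin n, termSign ε (p k.castSucc) * termSign ε (p k.succ) < 0)
    (d₀ g₁ g₂ : ℕ) (a₁ a₂ : Fin K → ℕ) (h₁ : ∀ l, a₁ l ≤ 1) (h₂ : ∀ l, a₂ l ≤ 1)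
    (hd : ∀ l, d l = d₀ + a₁ l * g₁ + a₂ l * g₂) :
    n + 1 ≤ (m + 1) ^ 2 := by
  refine chain_succ_le_pow_of_unitDigits d v ε θ p hθ hdom halt (r := 2) d₀ ![g₁, g₂] (fun l => ![a₁ l, a₂ l]) ?_ ?_
  · intro l j
    fin_cases j
    · exact h₁ l
    · exact h₂ l
  · intro l
    rw [hd l, Fin.sum_univ_two]
    simp only [Matrix.cons_val_zero, Matrix.cons_val_one]
    ring

end Summit.ValiantsHypothesis.ValiantsHypothesis.Theorems.KPlusLogSqLaw.Sumset
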